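/-
Origin: expansion seat `planner-pub-hodgecm-prl1-g11-0`, handover #1 2026-08-18T18:51Z md5 5e4b37d80c3caa1b2aa433dfc29eb94b (E2′; NEW additive KERNEL leaf, 400 l.; imports PKG HodgeCM.Automorphic.SignRecipeEndStateAllChars ONLY, NO import rewrite, nothing landed imports it, land in any order; lake env lean vs PKG r31: rc 0, 0 errors, 0 warnings, 0 proof holes; #print axioms trio on HodgeCM.Assembly.perL_ofSignRecipe₇' / realisationExists_ofSignRecipe₇' / ModelAx (`HOME/pub-hodgecm-prl1-g11/lean/EndStatePerLAxioms.lean`, md5 5e4b37d8, 400 lines);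
landed by the packager successor (mc-unitary-1-g3, gen-8 kit) in gate run 32 as `HodgeCM/Model/EndStatePerLAxioms.lean` (verbatim).
-/
/-
Origin: KEPT seat "PerL residual", session `planner-pub-hodgecm-prl1-g11-0` (unit pub-hodgecm-prl1-g11), 2026-08-18.
STAGED as `HOME/pub-hodgecm-prl1-g11/lean/EndStatePerLAxioms.lean`; intended final place (packager's call):
`HodgeCM/Model/EndStatePerLAxioms.lean`.  ADDITIVE LEAF: one package import, no existing declaration touched, no new
hypothesis of any kind — every statement below is kernel-proved from the package as it stands
(`#print axioms` = `[propext, Classical.choice, Quot.sound]` throughout).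
-/
import Summits.HodgeConjecture.HodgeCM.Automorphic.SignRecipeEndStateAllChars_2

/-!
# E2′ — the PerL END STATE over the FIVE model facts its proof uses

**Question** (MODEL-DAG §2b(iii) "G0 E2′ cut"; MODEL-SCOPE A.2 O6).  The END STATE of record
E2 = `HodgeCM.Assembly.perL_ofSignRecipe₇ (M : U.ModelAxioms) (h : Bool) (C : U.AdelicThetaCore₀) (d12 d34)
(A : (C.thetaModel h d12 d34).AllCharsNonDesign) (hHR : U.Fact_hodgeRiemann20) : U.PerL` takes the whole record
`U.ModelAxioms` (28 model facts, `HodgeCM.Geometry.Facts` l.263).  Which fields does the PROOF use?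

**Kernel-level measurement** (seat tool `work/ConeMA.lean`: sharing-aware traversal of the types AND the proof terms
of all package constants reachable from `perL_ofSignRecipe₇` — 3704 constants —, recording every primitive
projection `Expr.proj ``ModelAxioms i _` and every use of a projection function `ModelAxioms.<field>`; reproduce with
`lake env lean work/ConeMA.lean`, 96 s on the hub):
* the proof term projects out of `M` exactly FIVE of the 28 fields — `pull_comp`, `pull_cup`, `pull_hodge`,
  `cup2_hodge` (`Facts.lean` ll.37–54; FACTS.md rows M1 (its `pull_comp` half), M2, M3, M4) and `pms_dim`
  (`= U.PmsDimTwo`, `Statements.lean` l.139; FACTS.md row M15/M16);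
* no `ModelAxioms.rec` / `casesOn` / anonymous-constructor match on `M` occurs anywhere in the cone, so no other
  field enters through pattern matching;
* of the 22 fields of `U : Universe`, the cone of `perL_ofSignRecipe₇` projects 21 (all but `instFinite`), but 7 of
  those (`alg`, `idMor`, `prod`, `fst`, `snd`, `IsAbelianVariety`, `IsCMAbelianVariety`) only inside the statements of
  UNUSED `ModelAxioms` fields: the cone of the re-derived `perL_ofSignRecipe₇'` below projects 14 — `Var`, `dim`,
  `Coh`, `instAddCommGroup`, `instModule`, `hodge`, `Mor`, `comp`, `pull`, `cup`, `tr`, `cmAV`, `cmAct`, `pms` (the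
  statement `U.PerL` alone reads 12 of them; `dim` enters through `hHR` / `pms_dim`, `comp` through `pull_comp`);
* exactly 17 constants of the cone mention `ModelAxioms`: the structure, the 5 projection functions, and the 11
  theorems re-derived below, in dependency order (direct field uses in brackets): `Universe.cup2C_mem_F2` [cup2_hodge]
  · `Universe.ThetaModel.emb_ne_zero` [pms_dim] · `StubTree.thm44_of_realisation` [pull_comp, pull_hodge] ·
  `Universe.ThetaModel.nonempty_thetaRealisation_of_seesaw` [pull_cup, pull_hodge] · `StubTree.perL44_holds` ·
  `Universe.ThetaModel.nonempty_thetaRealisation''` · `Assembly.perL` · `Universe.ThetaModel.realisationExistsPerL_of''`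
  · `Assembly.perL_theta''` · `Universe.ThetaModel.perL_allChars` · `Assembly.perL_ofSignRecipe₇`.

**Answer, as a kernel artefact.**  This file introduces the record `HodgeCM.Universe.ModelAxiomsPerL` of exactly those
five facts (same field names, same statements — a SUB-RECORD of `ModelAxioms`: `HodgeCM.Universe.ModelAxioms.toPerL`),
re-derives the eleven theorems over it with the package's own proof texts (only the type of the binder `M` changes;
names `HodgeCM.Universe.ModelAxiomsPerL.<original short name>`), adds the POINTWISE form
`ModelAxiomsPerL.nonempty_thetaRealisation_at` of the realisation construction (all seven theta-model inputs, the two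
PRINT facts included, demanded only at the hermitian space `V` and seesaw context `c` at hand — the shape node E of the
model-construction DAG instantiates), and states

  `HodgeCM.Assembly.perL_ofSignRecipe₇' (M : U.ModelAxiomsPerL) (h) (C) (d12 d34) (A) (hHR) : U.PerL`

together with `HodgeCM.Assembly.realisationExists_ofSignRecipe₇'` (both realisation inputs; that proof does not even
use `pull_comp`).  The END STATE of record is the special case `M := M.toPerL` (closing `example`s).

Reading for the MODEL-CONSTRUCTION sub-cell: the model-fact burden of node E2 on a constructed universe is
`(g ∘ f)^* = f^* ∘ g^*`, `f^*(x ∪ y) = f^*x ∪ f^*y`, `f^*_ℂ F^p ⊆ F^p`, `F^p H^k ∪ F^q H^k ⊆ F^{p+q} H^{2k}` and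
`dim P_Γ = 2` — besides, as before, `hHR`, the two PRINT facts and five OPEN inputs inside `A`, and the data `C`.
Nothing about algebraic classes, Lefschetz (1,1), Künneth, traces / duality or the CM abelian varieties as such
(`Fact_cmAV`, `Fact_eigenLine`, `Fact_alphaLine`, `Fact_cmDominated`, …) is consumed on the PerL path (COR-CM only),
and of `U` itself only the 14 fields above occur (`alg`, `idMor`, `prod`/`fst`/`snd`, `IsAbelianVariety`,
`IsCMAbelianVariety`, `instFinite` do not).

Self-check (seat scratches `work/CheckE2prime{0,1}.lean` = this file + the cone tool): the cone of `perL_ofSignRecipe₇'`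
∪ `realisationExists_ofSignRecipe₇'` contains NO constant mentioning `ModelAxioms` (0 of 28 fields), projects 14 of 22
`Universe` fields, and uses all 5 fields of `ModelAxiomsPerL` (`realisationExists_ofSignRecipe₇'` alone: 4, not
`pull_comp`); `#print axioms` of both and of `nonempty_thetaRealisation_at` = `[propext, Classical.choice, Quot.sound]`.
-/

noncomputable section

open scoped TensorProduct InnerProductSpace Matrix

namespace HodgeCM

open Literature.AlgebraicGeometry.Motives (CMType HodgeStructure)
open Literature.AlgebraicGeometry.Motives.HodgeStructure (conj)
open HodgeCM.Prior.Perl34File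

namespace Universe

variable (U : Universe)

/-- **The five model facts on the PerL path** — the sub-record of `HodgeCM.Universe.ModelAxioms`
(`HodgeCM.Geometry.Facts` l.263) consisting of exactly the fields that the proof term of
`HodgeCM.Assembly.perL_ofSignRecipe₇` projects (kernel-measured; module docstring).  Field names and statements are
those of `ModelAxioms` VERBATIM (fields 2, 3, 4, 5, 17 of 28). -/
structure ModelAxiomsPerL : Prop where
  /-- `(g ∘ f)^* = f^* ∘ g^*` — `Fact_pull_comp` (`Facts.lean` l.37; FACTS.md row M1, second half). -/
  pull_comp : U.Fact_pull_comp
  /-- `f^*(x ∪ y) = f^*x ∪ f^*y` — `Fact_pull_cup` (l.42; FACTS.md row M2). -/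
  pull_cup : U.Fact_pull_cup
  /-- `f^*_ℂ (F^p H^k(Y)) ⊆ F^p H^k(X)` — `Fact_pull_hodge` (l.47; FACTS.md row M3). -/
  pull_hodge : U.Fact_pull_hodge
  /-- `F^p H^k ∪ F^q H^k ⊆ F^{p+q} H^{2k}` — `Fact_cup2_hodge` (l.52; FACTS.md row M4). -/
  cup2_hodge : U.Fact_cup2_hodge
  /-- `dim P_Γ = 2` — `PmsDimTwo` (`Statements.lean` l.139; FACTS.md row M15/M16). -/
  pms_dim : U.PmsDimTwo

variable {U}

/-- The record of 28 model facts contains the five. -/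
theorem ModelAxioms.toPerL (M : U.ModelAxioms) : U.ModelAxiomsPerL :=
  ⟨M.pull_comp, M.pull_cup, M.pull_hodge, M.cup2_hodge, M.pms_dim⟩

namespace ModelAxiomsPerL

/-! ### The eleven `M`-carrying theorems of the cone, re-derived over the five facts
(the package's proof texts; only the type of the binder `M` changes, and `T` becomes an explicit binder) -/

/-- = `Universe.cup2C_mem_F2` (`Proofs.RealisationConstruction` l.235): the cup of two `(1,0)`-classes lies in `F²H²`.
Uses `cup2_hodge`. -/
theorem cup2C_mem_F2 (M : U.ModelAxiomsPerL) (X : U.Var) {a b : U.CohC X 1} (ha : a ∈ U.H10 X)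
    (hb : b ∈ U.H10 X) : U.cup2C X 1 a b ∈ (U.hodge X 2).F 2 :=
  M.cup2_hodge X 1 1 1 a b (H10_le_F1 X ha) (H10_le_F1 X hb)

/-- **A nonzero holomorphic 2-form has a nonzero `L²` function, AT ONE LEVEL** — the proof body of
`Universe.ThetaModel.emb_ne_zero` (`Proofs.RealisationConstruction` l.245) with the PRINT fact `Fact_innerEmb` demanded
only at the level `Γ` in question (its body at `Γ` is the hypothesis `hI`).  Uses `pms_dim`. -/
theorem emb_ne_zero_at (M : U.ModelAxiomsPerL) (T : U.ThetaModel) {L : CMField} {ι₁ : L →+* ℂ}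
    {V : HermSpace3 L ι₁} (Γ : Level V)
    (hI : ∃ c : ℂ, c ≠ 0 ∧ ∀ η η' : U.CohC (U.pms L ι₁ V Γ) 2,
      η ∈ (U.hodge (U.pms L ι₁ V Γ) 2).F 2 → η' ∈ (U.hodge (U.pms L ι₁ V Γ) 2).F 2 →
      ⟪T.emb Γ η', T.emb Γ η⟫_ℂ = c * U.trC (U.pms L ι₁ V Γ) 4 (U.cup2C (U.pms L ι₁ V Γ) 2 η (conj η')))
    (hHR : U.Fact_hodgeRiemann20) {η : U.CohC (U.pms L ι₁ V Γ) 2} (hη : η ∈ (U.hodge (U.pms L ι₁ V Γ) 2).F 2)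
    (hne : η ≠ 0) : T.emb Γ η ≠ 0 := by
  obtain ⟨c, hc, h⟩ := hI
  intro h0
  have h1 := h η η hη hη
  rw [h0, inner_zero_left] at h1
  rcases mul_eq_zero.mp h1.symm with h2 | h2
  · exact hc h2
  · exact hHR _ (M.pms_dim L ι₁ V Γ) η hη hne h2

/-- = `Universe.ThetaModel.emb_ne_zero` (`Proofs.RealisationConstruction` l.245): a nonzero holomorphic 2-form has a
nonzero `L²` function (Petersson = cup pairing, Hodge–Riemann, `dim P_Γ = 2`).  Uses `pms_dim`. -/
theorem emb_ne_zero (M : U.ModelAxiomsPerL) (T : U.ThetaModel) (hI : T.Fact_innerEmb)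
    (hHR : U.Fact_hodgeRiemann20) {L : CMField} {ι₁ : L →+* ℂ} {V : HermSpace3 L ι₁} (Γ : Level V)
    {η : U.CohC (U.pms L ι₁ V Γ) 2} (hη : η ∈ (U.hodge (U.pms L ι₁ V Γ) 2).F 2) (hne : η ≠ 0) :
    T.emb Γ η ≠ 0 :=
  emb_ne_zero_at M T Γ (hI Γ) hHR hη hne

/-- = `StubTree.thm44_of_realisation` (`StubTree.PerLProof` l.142): PerL Thm 4.4 from the realisation data.
Uses `pull_comp`, `pull_hodge`. -/
theorem thm44_of_realisation (M : U.ModelAxiomsPerL) {L : CMField} {ι₁ : L →+* ℂ}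
    {V : HermSpace3 L ι₁} {K : CMField} {Ψ : Fin 4 → CMType K} {σ : K →+* ℂ}
    (R : U.ThetaRealisation ι₁ V K Ψ σ) : U.PeriodNV ι₁ V K Ψ σ := by
  classical
  -- Step 1: a nonzero (12)-wedge of theta one-forms at some level Γ₁ (Prop 4.3); it lies in S₁₂ = S₃₄
  obtain ⟨Γ₁, ω₁, hω₁, ω₂, hω₂, hv⟩ := R.lineField
  have hvS : R.Λ Γ₁ ω₁ ω₂ ∈ R.S.t34.S12 := by
    rw [← R.S.C2_S12_eq_S34]
    exact R.gen12 Γ₁ ω₁ ω₂ hω₁ hω₂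
  -- Step 2: it pairs non-trivially with some generator ϑ₃₄(χ, Φ) of S₃₄
  rw [R.S.t34.S12_def] at hvS
  obtain ⟨u, ⟨χ, -, Φ, rfl⟩, hχ⟩ :=
    StubTree.exists_inner_ne_zero_of_mem_closure_span (inner_self_ne_zero.mpr hv) hvS
  -- Step 3: that generator lies in the closed span of ALL (34)-wedges of theta one-forms
  obtain ⟨u, ⟨Γ₂, ω₃, hω₃, ω₄, hω₄, rfl⟩, hu⟩ :=
    StubTree.exists_inner_ne_zero_of_mem_closure_span hχ (R.real34 χ (R.S.H_chars34 χ) Φ)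
  -- Step 4: pass to a common level
  obtain ⟨Γ, hΓ₁, hΓ₂⟩ := R.level_inf Γ₁ Γ₂
  let ω : Fin 4 → U.CohC (U.pms L ι₁ V Γ) 1 := fun i => match i with
    | 0 => U.pullC (R.cover Γ₁ Γ hΓ₁) 1 ω₁
    | 1 => U.pullC (R.cover Γ₁ Γ hΓ₁) 1 ω₂
    | 2 => U.pullC (R.cover Γ₂ Γ hΓ₂) 1 ω₃
    | 3 => U.pullC (R.cover Γ₂ Γ hΓ₂) 1 ω₄
  have hU : ∀ i, ω i ∈ U.Uiso Γ K (Ψ i) σ := by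
    intro i
    match i with
    | 0 => exact Universe.pullC_mem_Uiso M.pull_comp _ K (Ψ 0) σ (R.Theta_sub 0 Γ₁ hω₁)
    | 1 => exact Universe.pullC_mem_Uiso M.pull_comp _ K (Ψ 1) σ (R.Theta_sub 1 Γ₁ hω₂)
    | 2 => exact Universe.pullC_mem_Uiso M.pull_comp _ K (Ψ 2) σ (R.Theta_sub 2 Γ₂ hω₃)
    | 3 => exact Universe.pullC_mem_Uiso M.pull_comp _ K (Ψ 3) σ (R.Theta_sub 3 Γ₂ hω₄)
  have hinner : ⟪R.Λ Γ (ω 2) (ω 3), R.Λ Γ (ω 0) (ω 1)⟫_ℂ ≠ 0 := by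
    have e12 : R.Λ Γ (ω 0) (ω 1) = R.Λ Γ₁ ω₁ ω₂ := R.Λ_cover Γ₁ Γ hΓ₁ ω₁ ω₂
    have e34 : R.Λ Γ (ω 2) (ω 3) = R.Λ Γ₂ ω₃ ω₄ := R.Λ_cover Γ₂ Γ hΓ₂ ω₃ ω₄
    rw [e12, e34]
    intro h0
    apply hu
    rw [← inner_conj_symm, h0, map_zero]
  -- Step 5: Petersson pairing = period (all four classes are holomorphic one-forms)
  obtain ⟨c, -, hcΛ⟩ := R.inner_Λ Γ
  have hper : U.period (U.pms L ι₁ V Γ) ω ≠ 0 := by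
    have h := hcΛ ω (fun i => Universe.Uiso_le_H10 M.pull_hodge Γ K (Ψ i) σ (hU i))
    intro h0
    rw [h0, mul_zero] at h
    exact hinner h
  -- Step 6: multilinear expansion to pure pullbacks
  exact Universe.periodNV_of_period_ne_zero Γ ω hU hper

/-- **The theta realisation at ONE context `(V, c)`, over the five facts** — the construction body of
`Universe.ThetaModel.nonempty_thetaRealisation_of_seesaw` (`Proofs.SeesawConstruction` l.407; =
`RealisationConstruction.nonempty_thetaRealisation_ofD`, PerL v5 Def 3.2 – §4) with the two PRINT facts demanded only
at the levels of the GIVEN `V` (`h₁`, `h₂` = the bodies of `Fact_embCover`, `Fact_innerEmb` at `V`) and the six OPEN input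
bodies demanded only AT `(V, c)`.  The hypothesis types `h₅ … h₁₀` are the bodies `ThetaSubAt`,
`ThetaWedgeAt`, `ThetaGen12At`, `ThetaReal34At`, `CharsAt`, `OccAt` of the carver's `HodgeCM/Model/ThetaModelExists.lean`
§3 written out, so that file's pointwise theorem over `ModelAxioms` becomes this one over the five facts by `exact`.
Uses `pull_cup`, `pull_hodge` directly and `cup2_hodge`, `pms_dim` through the two lemmas above; `LevelDirected` is
the in-package theorem `levelDirected`. -/
theorem nonempty_thetaRealisation_at (M : U.ModelAxiomsPerL) (T : U.ThetaModel) (hHR : U.Fact_hodgeRiemann20)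
    {L : CMField} {ι₁ : L →+* ℂ} (V : HermSpace3 L ι₁) (c : SeesawCtx L)
    (h₁ : ∀ (Γ Γ' : Level V) (h : Γ'.Γ ≤ Γ.Γ) (η : U.CohC (U.pms L ι₁ V Γ) 2),
      T.emb Γ' (U.pullC (T.cover Γ Γ' h) 2 η) = T.emb Γ η)
    (h₂ : ∀ Γ : Level V, ∃ c : ℂ, c ≠ 0 ∧ ∀ η η' : U.CohC (U.pms L ι₁ V Γ) 2,
      η ∈ (U.hodge (U.pms L ι₁ V Γ) 2).F 2 → η' ∈ (U.hodge (U.pms L ι₁ V Γ) 2).F 2 →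
      ⟪T.emb Γ η', T.emb Γ η⟫_ℂ = c * U.trC (U.pms L ι₁ V Γ) 4 (U.cup2C (U.pms L ι₁ V Γ) 2 η (conj η')))
    (h₅ : ∀ (i : Fin 4) (Γ : Level V), T.Theta V c i Γ ⊆ U.Uiso Γ c.K (c.Ψ i) c.σ)
    (h₆ : ∃ Γ : Level V, ∃ ω₁ ∈ T.Theta V c 0 Γ, ∃ ω₂ ∈ T.Theta V c 1 Γ, U.cup2C (U.pms L ι₁ V Γ) 1 ω₁ ω₂ ≠ 0)
    (h₇ : ∀ (Γ : Level V) (ω₁ ω₂ : U.CohC (U.pms L ι₁ V Γ) 1), ω₁ ∈ T.Theta V c 0 Γ → ω₂ ∈ T.Theta V c 1 Γ →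
      T.Λ Γ ω₁ ω₂ ∈ (T.t12 V c).S12)
    (h₈ : ∀ χ : (T.t34 V c).X, (T.t34 V c).allowed χ → ∀ Φ : T.SK V c,
      (T.t34 V c).ϑ χ Φ ∈ (Submodule.span ℂ (T.wedgeSet V c 2 3)).topologicalClosure)
    (h₉ : (∀ χ : (T.t12 V c).X, (T.t12 V c).allowed χ) ∧ (∀ χ : (T.t34 V c).X, (T.t34 V c).allowed χ))
    (h₁₀ : (∀ (Φ : T.SK V c) (i : T.SigIdx V c),
        (∃ v ∈ (T.core V c).hatσ i, (T.core V c).TΦ Φ v ≠ 0) → (T.t12 V c).wOccurs i) ∧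
      (∀ (Φ : T.SK V c) (i : T.SigIdx V c),
        (∃ v ∈ (T.core V c).hatσ i, (T.core V c).TΦ Φ v ≠ 0) → (T.t34 V c).wOccurs i)) :
    Nonempty (U.ThetaRealisation ι₁ V c.K c.Ψ c.σ) := by
  have hH10 : ∀ (i : Fin 4) (Γ : Level V), ∀ ω ∈ T.Theta V c i Γ, ω ∈ U.H10 (U.pms L ι₁ V Γ) :=
    fun i Γ ω hω => U.Uiso_le_H10 M.pull_hodge Γ c.K (c.Ψ i) c.σ (h₅ i Γ hω)
  refine ⟨{
    H := T.H V c
    HG := T.HG L ι₁ V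
    CG := T.CG V c
    G := T.G V c
    SK := T.SK V c
    SigIdx := T.SigIdx V c
    SigIdxG := T.SigIdxG V c
    S := { core := T.core V c, t12 := T.t12 V c, t34 := T.t34 V c
           H_chars12 := h₉.1, H_chars34 := h₉.2
           H_occ12 := h₁₀.1, H_occ34 := h₁₀.2 }
    Λ := fun Γ => T.Λ Γ
    Theta := fun i Γ => T.Theta V c i Γ
    Theta_sub := fun i Γ => h₅ i Γ
    lineField := ?_
    gen12 := fun Γ ω₁ ω₂ e₁ e₂ => h₇ Γ ω₁ ω₂ e₁ e₂
    real34 := fun χ hχ Φ => h₈ χ hχ Φ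
    cover := fun Γ Γ' h => T.cover Γ Γ' h
    Λ_cover := ?_
    level_inf := levelDirected L ι₁ V
    inner_Λ := ?_ }⟩
  · -- Prop 4.3 on forms ⇒ on L² functions (Hodge–Riemann)
    obtain ⟨Γ, ω₁, e₁, ω₂, e₂, hne⟩ := h₆
    exact ⟨Γ, ω₁, e₁, ω₂, e₂,
      emb_ne_zero_at M T Γ (h₂ Γ) hHR (cup2C_mem_F2 M _ (hH10 0 Γ ω₁ e₁) (hH10 1 Γ ω₂ e₂)) hne⟩
  · -- level independence of the wedge-function
    intro Γ Γ' h ω ω'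
    show T.emb Γ' (U.cup2C _ 1 (U.pullC (T.cover Γ Γ' h) 1 ω) (U.pullC (T.cover Γ Γ' h) 1 ω')) =
      T.emb Γ (U.cup2C _ 1 ω ω')
    rw [← pullC_cup2C M.pull_cup]
    exact h₁ Γ Γ' h _
  · -- Petersson = period
    intro Γ
    obtain ⟨c₀, hc₀, h⟩ := h₂ Γ
    refine ⟨c₀, hc₀, fun ω hω => ?_⟩
    show ⟪T.emb Γ (U.cup2C _ 1 (ω 2) (ω 3)), T.emb Γ (U.cup2C _ 1 (ω 0) (ω 1))⟫_ℂ = c₀ * U.period _ ω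
    rw [h _ _ (cup2C_mem_F2 M _ (hω 0) (hω 1)) (cup2C_mem_F2 M _ (hω 2) (hω 3)), conj_cup2C _ 1]
    rfl

/-- Pointwise construction, all-characters form (= the carver's `nonempty_thetaRealisation_at_allChars`): if every
character is allowed at `c`, the `S₁₂^all`-target body and the every-character reality body suffice. -/
theorem nonempty_thetaRealisation_at_allChars (M : U.ModelAxiomsPerL) (T : U.ThetaModel)
    (hHR : U.Fact_hodgeRiemann20) {L : CMField} {ι₁ : L →+* ℂ} (V : HermSpace3 L ι₁) (c : SeesawCtx L)
    (h₁ : ∀ (Γ Γ' : Level V) (h : Γ'.Γ ≤ Γ.Γ) (η : U.CohC (U.pms L ι₁ V Γ) 2),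
      T.emb Γ' (U.pullC (T.cover Γ Γ' h) 2 η) = T.emb Γ η)
    (h₂ : ∀ Γ : Level V, ∃ c : ℂ, c ≠ 0 ∧ ∀ η η' : U.CohC (U.pms L ι₁ V Γ) 2,
      η ∈ (U.hodge (U.pms L ι₁ V Γ) 2).F 2 → η' ∈ (U.hodge (U.pms L ι₁ V Γ) 2).F 2 →
      ⟪T.emb Γ η', T.emb Γ η⟫_ℂ = c * U.trC (U.pms L ι₁ V Γ) 4 (U.cup2C (U.pms L ι₁ V Γ) 2 η (conj η')))
    (h₅ : ∀ (i : Fin 4) (Γ : Level V), T.Theta V c i Γ ⊆ U.Uiso Γ c.K (c.Ψ i) c.σ)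
    (h₆ : ∃ Γ : Level V, ∃ ω₁ ∈ T.Theta V c 0 Γ, ∃ ω₂ ∈ T.Theta V c 1 Γ, U.cup2C (U.pms L ι₁ V Γ) 1 ω₁ ω₂ ≠ 0)
    (h₇ : ∀ (Γ : Level V) (ω₁ ω₂ : U.CohC (U.pms L ι₁ V Γ) 1), ω₁ ∈ T.Theta V c 0 Γ → ω₂ ∈ T.Theta V c 1 Γ →
      T.Λ Γ ω₁ ω₂ ∈ (Submodule.span ℂ
        {u : T.HG L ι₁ V | ∃ (χ : (T.t12 V c).X) (Φ : T.SK V c), u = (T.t12 V c).ϑ χ Φ}).topologicalClosure)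
    (h₈ : ∀ (χ : (T.t34 V c).X) (Φ : T.SK V c),
      (T.t34 V c).ϑ χ Φ ∈ (Submodule.span ℂ (T.wedgeSet V c 2 3)).topologicalClosure)
    (h₉ : (∀ χ : (T.t12 V c).X, (T.t12 V c).allowed χ) ∧ (∀ χ : (T.t34 V c).X, (T.t34 V c).allowed χ))
    (h₁₀ : (∀ (Φ : T.SK V c) (i : T.SigIdx V c),
        (∃ v ∈ (T.core V c).hatσ i, (T.core V c).TΦ Φ v ≠ 0) → (T.t12 V c).wOccurs i) ∧
      (∀ (Φ : T.SK V c) (i : T.SigIdx V c),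
        (∃ v ∈ (T.core V c).hatσ i, (T.core V c).TΦ Φ v ≠ 0) → (T.t34 V c).wOccurs i)) :
    Nonempty (U.ThetaRealisation ι₁ V c.K c.Ψ c.σ) :=
  nonempty_thetaRealisation_at M T hHR V c h₁ h₂ h₅ h₆
    (fun Γ ω₁ ω₂ e₁ e₂ => by
      rw [(T.t12 V c).S12_eq_allChars h₉.1, Prior.Perl34File.Perl34.TorusData.allChars_S12]
      exact h₇ Γ ω₁ ω₂ e₁ e₂)
    (fun χ _ Φ => h₈ χ Φ) h₉ h₁₀

/-- = `Universe.ThetaModel.nonempty_thetaRealisation_of_seesaw` (`Proofs.SeesawConstruction` l.407): the theta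
realisation data from a forced-sign seesaw datum — here the specialisation of `nonempty_thetaRealisation_at` to the
context `⟨K, Ψ, σ, D⟩` (the original's vestigial hypothesis `hLD : LevelDirected` is discharged by `levelDirected`, as
`nonempty_thetaRealisation''` does). -/
theorem nonempty_thetaRealisation_of_seesaw (M : U.ModelAxiomsPerL) (T : U.ThetaModel) (A : T.Inputs)
    (hHR : U.Fact_hodgeRiemann20) {K L : CMField} (j : K →+* L) (ι₁ : L →+* ℂ)
    (Ψ : Fin 4 → CMType K) (σ : K →+* ℂ) (hσ : ι₁.comp j = σ) (hΨ : PairSum Ψ)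
    (hinj : Function.Injective Ψ) (hmem : ∀ i, σ ∈ (Ψ i).1) (V : HermSpace3 L ι₁)
    (D : StubTree.SeesawDatum L) (hD : T.SignsForced K L j ι₁ Ψ D) :
    Nonempty (U.ThetaRealisation ι₁ V K Ψ σ) := by
  let c : SeesawCtx L := ⟨K, Ψ, σ, D⟩
  have hc : T.GoodCtx ι₁ c := ⟨hΨ, hinj, hmem, ⟨j, hσ, hD⟩⟩
  exact nonempty_thetaRealisation_at M T hHR V c (fun Γ Γ' h η => A.embCover Γ Γ' h η) (fun Γ => A.innerEmb Γ)
    (A.thetaSub V c hc) (A.thetaWedge V c hc) (A.thetaGen12 V c hc) (A.thetaReal34 V c hc) (A.chars V c hc)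
    (A.occ V c hc)

/-- = `StubTree.perL44_holds` (`StubTree.PerLProof` l.192): PerL Thm 4.4 from the open input `RealisationExistsPerL`. -/
theorem perL44_holds (M : U.ModelAxiomsPerL) (hR : U.RealisationExistsPerL) : U.PerL44 := by
  intro K L j hN hK hL φ hφ ι₁ hι t ht V
  obtain ⟨R⟩ := hR K L j hN hK hL φ hφ ι₁ hι t ht V
  exact thm44_of_realisation M R

/-- = `Universe.ThetaModel.nonempty_thetaRealisation''` (`Proofs.SeesawConstruction` l.459): the same with
`LevelDirected` and the seesaw datum discharged in-package (`levelDirected`, `exists_seesawDatum_constructed`). -/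
theorem nonempty_thetaRealisation'' (M : U.ModelAxiomsPerL) (T : U.ThetaModel) (A : T.Inputs)
    (hHR : U.Fact_hodgeRiemann20) {K L : CMField} (j : K →+* L) (ι₁ : L →+* ℂ)
    (Ψ : Fin 4 → CMType K) (σ : K →+* ℂ) (hσ : ι₁.comp j = σ) (hΨ : PairSum Ψ)
    (hinj : Function.Injective Ψ) (hmem : ∀ i, σ ∈ (Ψ i).1) (V : HermSpace3 L ι₁) :
    Nonempty (U.ThetaRealisation ι₁ V K Ψ σ) := by
  obtain ⟨D, hD⟩ := T.exists_seesawDatum_constructed A.kappaConj A.frameSignConj j ι₁ Ψ hΨ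
  exact nonempty_thetaRealisation_of_seesaw M T A hHR j ι₁ Ψ σ hσ hΨ hinj hmem V D hD

/-- = `Assembly.perL` (`Assembly.CorCM` l.59): `W_per^L` from `RealisationExistsPerL` (Landherr existence is the
in-package theorem `StubTree.landherr_exists`). -/
theorem perL (M : U.ModelAxiomsPerL) (hR : U.RealisationExistsPerL) : U.PerL :=
  Assembly.perL_of_perL44 U StubTree.landherr_exists (perL44_holds M hR)

/-- = `Universe.ThetaModel.realisationExistsPerL_of''` (`Proofs.SeesawConstruction` l.469). -/
theorem realisationExistsPerL_of'' (M : U.ModelAxiomsPerL) (T : U.ThetaModel) (A : T.Inputs)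
    (hHR : U.Fact_hodgeRiemann20) : U.RealisationExistsPerL := by
  intro K L j _ hK _ φ hφ ι₁ hι₁ t ht V
  have hmem : ∀ i, φ 0 ∈ (t i).1 := fun i => (ht i 0).mpr (by fin_cases i <;> rfl)
  exact nonempty_thetaRealisation'' M T A hHR j ι₁ t (φ 0) hι₁
    (StubTree.pairSum_of_isPerLTypes K φ hφ hK t ht) (StubTree.injective_of_isPerLTypes K φ hφ t ht) hmem V

/-- = `Universe.ThetaModel.realisationExistsFace_of''` (`Proofs.SeesawConstruction` l.478) — not on the PerL path;
carried because the realisation END STATE delivers both settings. -/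
theorem realisationExistsFace_of'' (M : U.ModelAxiomsPerL) (T : U.ThetaModel) (A : T.Inputs)
    (hHR : U.Fact_hodgeRiemann20) : U.RealisationExistsFace := by
  intro F _ _ f ι₁ hadm V
  exact nonempty_thetaRealisation'' M T A hHR (RingHom.id F) ι₁ f.psi ι₁ (RingHom.comp_id ι₁)
    (pairSum_psi f) (StubTree.psi_injective F f) (admissible_mem_psi f ι₁ hadm) V

/-- = `Assembly.perL_theta''` (`Proofs.SeesawConstruction` l.501). -/
theorem perL_theta'' (M : U.ModelAxiomsPerL) (T : U.ThetaModel) (A : T.Inputs)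
    (hHR : U.Fact_hodgeRiemann20) : U.PerL :=
  perL M (realisationExistsPerL_of'' M T A hHR)

/-- = `Universe.ThetaModel.perL_allChars` (`Automorphic.SignRecipeEndStateAllChars` l.337): PerL from the seven
all-characters inputs. -/
theorem perL_allChars (M : U.ModelAxiomsPerL) (T : U.ThetaModel) (A : T.AllCharsNonDesign)
    (hκ : T.Design_kappaConj) (hs : T.Design_frameSignConj) (hHR : U.Fact_hodgeRiemann20) : U.PerL :=
  perL_theta'' M T.allChars ((T.allChars_inputs_iff).mpr ⟨A, hκ, hs⟩) hHR

/-- = `Universe.ThetaModel.realisationExists_allChars` (l.330): both realisation inputs from the seven all-characters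
inputs. -/
theorem realisationExists_allChars (M : U.ModelAxiomsPerL) (T : U.ThetaModel) (A : T.AllCharsNonDesign)
    (hκ : T.Design_kappaConj) (hs : T.Design_frameSignConj) (hHR : U.Fact_hodgeRiemann20) :
    U.RealisationExistsPerL ∧ U.RealisationExistsFace :=
  ⟨realisationExistsPerL_of'' M T.allChars ((T.allChars_inputs_iff).mpr ⟨A, hκ, hs⟩) hHR,
    realisationExistsFace_of'' M T.allChars ((T.allChars_inputs_iff).mpr ⟨A, hκ, hs⟩) hHR⟩

end ModelAxiomsPerL

end Universe

/-! ## E2′ — the END STATE over the five facts -/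

namespace Assembly

open HodgeCM.Universe (AdelicThetaCore₀ SideData ThetaModel ModelAxiomsPerL)

variable (U : Universe)

/-- **E2′: PerL, `chars` eliminated, over the FIVE model facts** — `Assembly.perL_ofSignRecipe₇` with
`(M : U.ModelAxioms)` replaced by `(M : U.ModelAxiomsPerL)`; every other hypothesis verbatim. -/
theorem perL_ofSignRecipe₇' (M : U.ModelAxiomsPerL) (h : Bool) (C : U.AdelicThetaCore₀)
    (d12 d34 : ∀ {L : CMField}, SeesawCtx L → SideData L)
    (A : (C.thetaModel h d12 d34).AllCharsNonDesign) (hHR : U.Fact_hodgeRiemann20) : U.PerL :=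
  M.perL_allChars (C.thetaModel h d12 d34) A (C.design_kappaConj h d12 d34) (C.design_frameSignConj h d12 d34) hHR

/-- **The realisation END STATE over the five facts** — `Assembly.realisationExists_ofSignRecipe₇` likewise (its proof
uses `pull_cup`, `pull_hodge`, `cup2_hodge`, `pms_dim` only). -/
theorem realisationExists_ofSignRecipe₇' (M : U.ModelAxiomsPerL) (h : Bool) (C : U.AdelicThetaCore₀)
    (d12 d34 : ∀ {L : CMField}, SeesawCtx L → SideData L)
    (A : (C.thetaModel h d12 d34).AllCharsNonDesign) (hHR : U.Fact_hodgeRiemann20) :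
    U.RealisationExistsPerL ∧ U.RealisationExistsFace :=
  M.realisationExists_allChars (C.thetaModel h d12 d34) A (C.design_kappaConj h d12 d34)
    (C.design_frameSignConj h d12 d34) hHR

/-- The END STATE of record E2 is the special case `M.toPerL` of E2′. -/
example (M : U.ModelAxioms) (h : Bool) (C : U.AdelicThetaCore₀)
    (d12 d34 : ∀ {L : CMField}, SeesawCtx L → SideData L)
    (A : (C.thetaModel h d12 d34).AllCharsNonDesign) (hHR : U.Fact_hodgeRiemann20) : U.PerL :=
  perL_ofSignRecipe₇' U M.toPerL h C d12 d34 A hHR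


-- port_pkg: scope closed for this part
end Assembly
end HodgeCM
end
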